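import Mathlib
import HarnessLib
import Summits.ResolutionOfSingularities.ResolutionOfSingularities.Theorems.WildQuotientsWildQuotientResolutionS1aQhAbsCover
import Summits.ResolutionOfSingularities.ResolutionOfSingularities.Theorems.WildQuotientsWildQuotientResolutionS1aModelNodeCentre
import Summits.ResolutionOfSingularities.ResolutionOfSingularities.Theorems.WildQuotientsWildQuotientResolutionS1aA1Move2Model

/-!
# S1a — K-LOC (α1): the R4 root datum READ IN A LOCALISED POLYNOMIAL RING `L = k[x₀..x₃][1/hh]` (`σ hh = hh`) is an instance of the abstract datum

[OURS · L1 W4.5c · lead-1 g16; plan-1 RULINGS R-F15o/R-F15p (design (α1), K-LOC → R4e-rational): the node of an invariant basic open `D(e⁻¹hh)` is `L = k[x][1/hh]`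
(✓`exists_rootNodeAway`), so the ring-level inputs of ✓`exists_moveAtlas_of_nodes` over `L` come from ✓`…S1aQhAbsRoot` / ✓`…S1aQhAbsCover` once the abstract
hypotheses are discharged for `(L, τ = sigmaAway σ, f = (x₀/1, x₁/1, x₂/1), x₃/1, t/1, Gfix = {hh⁻¹} ∪ k)`] — NOT statements of the manuscript; counted 0; AI-level work, weaker
than expert review. Crux stmt-ResolutionOfSingularities-17941 `CyclicQuotientFourfolds`, line `s1a-logminvertex` v13 (`stub_reachLowerInFX`).

* `qhl_closure_eq_top` (generation of `L` by `x₀/1, x₁/1, x₂/1, x₃/1`, `hh⁻¹` and the constants), `qhl_fix` (`τ` fixes `hh⁻¹` and the constants), `qhl_rows` (the R4 rows of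
  `τ = sigmaAway σ` on the generators), `qhl_tail_mem` (`t/1 ∈ 𝒥_sh(f; w)`), `qhl_map_le` (σ-adaptedness over `L`), `qhl_charP`, `qhl_iterate`;
* K1′ over `L`: `qhl_isRegular` (✓`ModelNode.isRegular_algebraMap_X_away`), `qhl_isRegularRing_quotient` (✓`ModelNode.isRegularRing_quotient_X_away`);
* ★ `qhl_augmentationIdeal_sigmaR_le` / `qhl_u'_zero_mem_residual` / `qhl_tail_mem_residual` — (H1) and the residual memberships over `L` (✓QhAbs instantiated).
-/

set_option linter.dupNamespace false

noncomputable section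

open Literature.AlgebraicGeometry.Resolution
open scoped LaurentPolynomial
open MvPolynomial
open Summit.ResolutionOfSingularities.ResolutionOfSingularities.Theorems.WildQuotientResolution.S1
open Summit.ResolutionOfSingularities.ResolutionOfSingularities.Theorems.WildQuotientResolution.S1.CoarseChart
open Summit.ResolutionOfSingularities.ResolutionOfSingularities.Theorems.WildQuotientResolution.S1.NodeAway
open Summit.ResolutionOfSingularities.ResolutionOfSingularities.Theorems.WildQuotientResolution.S1.CentreAway
open Summit.ResolutionOfSingularities.ResolutionOfSingularities.Theorems.WildQuotientResolution.S1.GameFrame.GModel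

namespace Summit.ResolutionOfSingularities.ResolutionOfSingularities.Theorems.WildQuotientResolution.S1.KillCert.QhAway

variable {k : Type} [Field k] (σ : MvPolynomial (Fin 4) k ≃+* MvPolynomial (Fin 4) k) (hC : ∀ a : k, σ (C a) = C a)
  (h0 : σ (X 0) = X 0) (h1 : σ (X 1) = X 1 + X 0) (h2 : σ (X 2) = X 2) (t₀ : MvPolynomial (Fin 4) k) (h3 : σ (X 3) = X 3 + t₀)
  (w : Fin 3 → ℕ) (sh : ℕ) (hw0 : w 0 = w 1 + sh)
  (ht₀ : t₀ ∈ (weightedFiltration (fun i => (X ((![0, 1, 2] : Fin 3 → Fin 4) i) : MvPolynomial (Fin 4) k)) w).ideal sh)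
  (hh : MvPolynomial (Fin 4) k) (hσh : σ hh = hh)

/-- `a / xⁿ = (a/1) · (x⁻¹)ⁿ` in `Localization.Away x` (any commutative ring). [folklore] -/
theorem algebraMap_mul_invSelf_pow_eq_mk' {R : Type*} [CommRing R] (x a : R) (n : ℕ) :
    algebraMap R (Localization.Away x) a * IsLocalization.Away.invSelf x ^ n =
      IsLocalization.mk' (Localization.Away x) a (⟨x ^ n, n, rfl⟩ : Submonoid.powers x) := by
  rw [IsLocalization.eq_mk'_iff_mul_eq]
  have h1 : IsLocalization.Away.invSelf x * algebraMap R (Localization.Away x) x = 1 := by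
    rw [mul_comm]; exact IsLocalization.Away.mul_invSelf _
  change _ * algebraMap R (Localization.Away x) (x ^ n) = _
  rw [map_pow, mul_assoc, ← mul_pow, h1, one_pow, mul_one]

/-- **Generation of `L = k[x][1/hh]`** by `x₀/1, x₁/1, x₂/1`, `x₃/1`, `hh⁻¹` and the constants. -/
theorem qhl_closure_eq_top :
    Subring.closure (Set.range (fun i => algebraMap (MvPolynomial (Fin 4) k) (Localization.Away hh) (X ((![0, 1, 2] : Fin 3 → Fin 4) i))) ∪
      {algebraMap (MvPolynomial (Fin 4) k) (Localization.Away hh) (X 3)} ∪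
      ({IsLocalization.Away.invSelf hh} ∪ Set.range (algebraMap k (Localization.Away hh)))) = ⊤ := by
  set S := Subring.closure (Set.range (fun i => algebraMap (MvPolynomial (Fin 4) k) (Localization.Away hh) (X ((![0, 1, 2] : Fin 3 → Fin 4) i))) ∪
      {algebraMap (MvPolynomial (Fin 4) k) (Localization.Away hh) (X 3)} ∪
      ({IsLocalization.Away.invSelf hh} ∪ Set.range (algebraMap k (Localization.Away hh)))) with hS
  have hX : ∀ l : Fin 4, algebraMap (MvPolynomial (Fin 4) k) (Localization.Away hh) (X l) ∈ S := by
    intro l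
    fin_cases l
    · exact Subring.subset_closure (Or.inl (Or.inl ⟨0, rfl⟩))
    · exact Subring.subset_closure (Or.inl (Or.inl ⟨1, rfl⟩))
    · exact Subring.subset_closure (Or.inl (Or.inl ⟨2, rfl⟩))
    · exact Subring.subset_closure (Or.inl (Or.inr rfl))
  have hP : ∀ z : MvPolynomial (Fin 4) k, algebraMap (MvPolynomial (Fin 4) k) (Localization.Away hh) z ∈ S := by
    intro z
    induction z using MvPolynomial.induction_on with
    | C a =>
      refine Subring.subset_closure (Or.inr (Or.inr ⟨a, ?_⟩))
      rw [IsScalarTower.algebraMap_apply k (MvPolynomial (Fin 4) k) (Localization.Away hh) a, MvPolynomial.algebraMap_eq]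
    | add p q hp hq => rw [map_add]; exact add_mem hp hq
    | mul_X p i hp => rw [map_mul]; exact mul_mem hp (hX i)
  refine top_le_iff.mp fun z _ => ?_
  obtain ⟨a, ⟨_, n, rfl⟩, rfl⟩ := IsLocalization.exists_mk'_eq (Submonoid.powers hh) z
  rw [← algebraMap_mul_invSelf_pow_eq_mk' hh a n]
  have hinv : IsLocalization.Away.invSelf hh ∈ S := Subring.subset_closure (Or.inr (Or.inl rfl))
  exact Subring.mul_mem S (hP a) (Subring.pow_mem S hinv n)

include hC in
/-- `τ = sigmaAway σ` fixes `hh⁻¹` and the constants. -/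
theorem qhl_fix : ∀ g ∈ ({IsLocalization.Away.invSelf hh} ∪ Set.range (algebraMap k (Localization.Away hh)) : Set (Localization.Away hh)), sigmaAway σ hσh g = g := by
  rintro g (hg | ⟨a, rfl⟩)
  · rw [Set.mem_singleton_iff.mp hg]; exact sigmaAway_invSelf σ hσh
  · rw [IsScalarTower.algebraMap_apply k (MvPolynomial (Fin 4) k) (Localization.Away hh) a, MvPolynomial.algebraMap_eq, sigmaAway_algebraMap, hC]

include h0 h1 h2 h3 in
/-- **The R4 rows of `τ = sigmaAway σ`** on `x₀/1, x₁/1, x₂/1, x₃/1`. -/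
theorem qhl_rows :
    sigmaAway σ hσh ((fun i => algebraMap (MvPolynomial (Fin 4) k) (Localization.Away hh) (X ((![0, 1, 2] : Fin 3 → Fin 4) i))) 0) =
        (fun i => algebraMap (MvPolynomial (Fin 4) k) (Localization.Away hh) (X ((![0, 1, 2] : Fin 3 → Fin 4) i))) 0 ∧
      sigmaAway σ hσh ((fun i => algebraMap (MvPolynomial (Fin 4) k) (Localization.Away hh) (X ((![0, 1, 2] : Fin 3 → Fin 4) i))) 1) =
        (fun i => algebraMap (MvPolynomial (Fin 4) k) (Localization.Away hh) (X ((![0, 1, 2] : Fin 3 → Fin 4) i))) 1 +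
          (fun i => algebraMap (MvPolynomial (Fin 4) k) (Localization.Away hh) (X ((![0, 1, 2] : Fin 3 → Fin 4) i))) 0 ∧
      sigmaAway σ hσh ((fun i => algebraMap (MvPolynomial (Fin 4) k) (Localization.Away hh) (X ((![0, 1, 2] : Fin 3 → Fin 4) i))) 2) =
        (fun i => algebraMap (MvPolynomial (Fin 4) k) (Localization.Away hh) (X ((![0, 1, 2] : Fin 3 → Fin 4) i))) 2 ∧
      sigmaAway σ hσh (algebraMap (MvPolynomial (Fin 4) k) (Localization.Away hh) (X 3 : MvPolynomial (Fin 4) k)) =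
        algebraMap (MvPolynomial (Fin 4) k) (Localization.Away hh) (X 3 : MvPolynomial (Fin 4) k) + algebraMap (MvPolynomial (Fin 4) k) (Localization.Away hh) t₀ := by
  refine ⟨?_, ?_, ?_, ?_⟩
  · change sigmaAway σ hσh (algebraMap _ _ (X 0)) = algebraMap _ _ (X 0); rw [sigmaAway_algebraMap, h0]
  · change sigmaAway σ hσh (algebraMap _ _ (X 1)) = algebraMap _ _ (X 1) + algebraMap _ _ (X 0); rw [sigmaAway_algebraMap, h1, map_add]
  · change sigmaAway σ hσh (algebraMap _ _ (X 2)) = algebraMap _ _ (X 2); rw [sigmaAway_algebraMap, h2]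
  · rw [sigmaAway_algebraMap, h3, map_add]

include ht₀ in
/-- The tail `t/1` lies in `𝒥_sh(f; w)` over `L`. -/
theorem qhl_tail_mem : algebraMap (MvPolynomial (Fin 4) k) (Localization.Away hh) t₀ ∈
    (weightedFiltration (fun i => algebraMap (MvPolynomial (Fin 4) k) (Localization.Away hh) (X ((![0, 1, 2] : Fin 3 → Fin 4) i))) w).ideal sh := by
  have h := Ideal.mem_map_of_mem (algebraMap (MvPolynomial (Fin 4) k) (Localization.Away hh)) ht₀
  rwa [CentreAway.map_weightedFiltration_ideal] at h

/-- The polynomial ring is generated by `x₀, x₁, x₂`, `x₃` and the constants (abstract-datum form). -/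
theorem poly_closure_eq_top :
    Subring.closure (Set.range (fun i => (X ((![0, 1, 2] : Fin 3 → Fin 4) i) : MvPolynomial (Fin 4) k)) ∪ {(X 3 : MvPolynomial (Fin 4) k)} ∪ Set.range (C : k → MvPolynomial (Fin 4) k)) = ⊤ := by
  rw [eq_top_iff, ← KillCert.closure_range_C_union_range_X_of k (Fin 4), Subring.closure_le]
  rintro g (⟨a, rfl⟩ | ⟨i, rfl⟩)
  · exact Subring.subset_closure (Or.inr ⟨a, rfl⟩)
  · fin_cases i
    · exact Subring.subset_closure (Or.inl (Or.inl ⟨0, rfl⟩))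
    · exact Subring.subset_closure (Or.inl (Or.inl ⟨1, rfl⟩))
    · exact Subring.subset_closure (Or.inl (Or.inl ⟨2, rfl⟩))
    · exact Subring.subset_closure (Or.inl (Or.inr rfl))

include hC h0 h1 h2 h3 hw0 ht₀ in
/-- σ-adaptedness of `𝒥(x₀,x₁,x₂; w)` on `k[x]` (the abstract lemma with `Gfix` = constants). -/
theorem qh_poly_map_le (n : ℕ) : ((weightedFiltration (fun i => (X ((![0, 1, 2] : Fin 3 → Fin 4) i) : MvPolynomial (Fin 4) k)) w).ideal n).map (σ : MvPolynomial (Fin 4) k →+* MvPolynomial (Fin 4) k) ≤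
    (weightedFiltration (fun i => (X ((![0, 1, 2] : Fin 3 → Fin 4) i) : MvPolynomial (Fin 4) k)) w).ideal n :=
  QhAbs.qha_map_le σ _ (X 3) t₀ w sh (Set.range (C : k → MvPolynomial (Fin 4) k)) h0 h1 h2 h3 (by rintro _ ⟨a, rfl⟩; exact hC a) (poly_closure_eq_top) hw0 ht₀ n

include hC h0 h1 h2 h3 hw0 ht₀ in
/-- **σ-adaptedness over `L`**: `τ(𝒥ₙ(f; w)) ≤ 𝒥ₙ(f; w)`. -/
theorem qhl_map_le (n : ℕ) : ((weightedFiltration (fun i => algebraMap (MvPolynomial (Fin 4) k) (Localization.Away hh) (X ((![0, 1, 2] : Fin 3 → Fin 4) i))) w).ideal n).map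
      (sigmaAway σ hσh : Localization.Away hh →+* Localization.Away hh) ≤
    (weightedFiltration (fun i => algebraMap (MvPolynomial (Fin 4) k) (Localization.Away hh) (X ((![0, 1, 2] : Fin 3 → Fin 4) i))) w).ideal n :=
  map_sigmaAway_weightedFiltration_le (fun i => (X ((![0, 1, 2] : Fin 3 → Fin 4) i) : MvPolynomial (Fin 4) k)) w σ hσh
    (qh_poly_map_le σ hC h0 h1 h2 t₀ h3 w sh hw0 ht₀) n

/-- `L` has characteristic `p` (`hh ≠ 0`). -/
theorem qhl_charP {p : ℕ} [CharP k p] (hh0 : hh ≠ 0) : CharP (Localization.Away hh) p := by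
  haveI : CharP (MvPolynomial (Fin 4) k) p := inferInstance
  exact charP_of_injective_ringHom (IsLocalization.injective (Localization.Away hh) (powers_le_nonZeroDivisors_of_noZeroDivisors hh0)) p

/-- `τᵖ = id` on `L`. -/
theorem qhl_iterate {p : ℕ} (hσp : ∀ a : MvPolynomial (Fin 4) k, (⇑σ)^[p] a = a) (y : Localization.Away hh) : (⇑(sigmaAway σ hσh))^[p] y = y :=
  sigmaAway_iterate_eq_self σ hσh hσp y

/-- **K1 over `L`**: `(x₀/1, x₁/1, x₂/1)` is a regular sequence as soon as `hh(0,0,0,a) ≠ 0` for some `a` (a point of the centre off `hh = 0`). -/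
theorem qhl_isRegular (g : Fin 4 → k) (hg0 : g 0 = 0) (hg1 : g 1 = 0) (hg2 : g 2 = 0) (hu : MvPolynomial.eval g hh ≠ 0) :
    RingTheory.Sequence.IsRegular (Localization.Away hh) (List.ofFn fun i => algebraMap (MvPolynomial (Fin 4) k) (Localization.Away hh) (X ((![0, 1, 2] : Fin 3 → Fin 4) i))) :=
  ModelNode.isRegular_algebraMap_X_away k hh (![0, 1, 2] : Fin 3 → Fin 4) (by decide) g (fun i => by fin_cases i <;> assumption) hu

/-- **K1′ over `L`**: `L ⧸ (x₀, x₁, x₂)` is regular. -/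
theorem qhl_isRegularRing_quotient :
    IsRegularRing (Localization.Away hh ⧸ Ideal.span (Set.range fun i => algebraMap (MvPolynomial (Fin 4) k) (Localization.Away hh) (X ((![0, 1, 2] : Fin 3 → Fin 4) i)))) :=
  ModelNode.isRegularRing_quotient_X_away k hh (![0, 1, 2] : Fin 3 → Fin 4)

/-! ## (H1) and the residual memberships over `L` (abstract lemmas instantiated) -/

section Residual

variable {p : ℕ} (hp : 0 < p) (hσp : ∀ a : MvPolynomial (Fin 4) k, (⇑σ)^[p] a = a)

set_option maxHeartbeats 1600000 in
include hC h0 h1 h2 h3 hw0 ht₀ in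
/-- ★ **(H1) over `L`**: `aug σ_R ≤ (s^sh)` on `R^w(L)`. -/
theorem qhl_augmentationIdeal_sigmaR_le
    (hσJ : ∀ n : ℕ, ((weightedFiltration (fun i => algebraMap (MvPolynomial (Fin 4) k) (Localization.Away hh) (X ((![0, 1, 2] : Fin 3 → Fin 4) i))) w).ideal n).map
      (sigmaAway σ hσh : Localization.Away hh →+* Localization.Away hh) ≤
        (weightedFiltration (fun i => algebraMap (MvPolynomial (Fin 4) k) (Localization.Away hh) (X ((![0, 1, 2] : Fin 3 → Fin 4) i))) w).ideal n) :
    augmentationIdeal (sigmaR (sigmaAway σ hσh) (fun i => algebraMap (MvPolynomial (Fin 4) k) (Localization.Away hh) (X ((![0, 1, 2] : Fin 3 → Fin 4) i))) w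
        hσJ hp (qhl_iterate σ hh hσh hσp)) ≤
      Ideal.span {cobordantAlgebra.s (fun i => algebraMap (MvPolynomial (Fin 4) k) (Localization.Away hh) (X ((![0, 1, 2] : Fin 3 → Fin 4) i))) w ^ sh} := by
  obtain ⟨r0, r1, r2, r3⟩ := qhl_rows σ h0 h1 h2 t₀ h3 hh hσh
  have hadm := QhAbs.qha_admissible_one (sigmaAway σ hσh) (fun i => algebraMap (MvPolynomial (Fin 4) k) (Localization.Away hh) (X ((![0, 1, 2] : Fin 3 → Fin 4) i)))
    (algebraMap (MvPolynomial (Fin 4) k) (Localization.Away hh) (X 3)) (algebraMap (MvPolynomial (Fin 4) k) (Localization.Away hh) t₀) w sh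
    (({IsLocalization.Away.invSelf hh} ∪ Set.range (algebraMap k (Localization.Away hh)) : Set (Localization.Away hh))) r0 r1 r2 r3 (qhl_fix σ hC hh hσh)
    (qhl_closure_eq_top hh) hw0 (qhl_tail_mem t₀ w sh ht₀ hh)
  have h := augmentationIdeal_sigmaR_le_span_of_admissible_shift
    (fun i => algebraMap (MvPolynomial (Fin 4) k) (Localization.Away hh) (X ((![0, 1, 2] : Fin 3 → Fin 4) i))) w (sigmaAway σ hσh) hσJ hp (qhl_iterate σ hh hσh hσp) sh 1 hadm
  rwa [map_one, one_mul] at h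

include h1 hw0 in
/-- ★ `u₀′ ∈ 𝔞` over `L` (the `[x₀]`-chart is killed). -/
theorem qhl_u'_zero_mem_residual
    (hσJ : ∀ n : ℕ, ((weightedFiltration (fun i => algebraMap (MvPolynomial (Fin 4) k) (Localization.Away hh) (X ((![0, 1, 2] : Fin 3 → Fin 4) i))) w).ideal n).map
      (sigmaAway σ hσh : Localization.Away hh →+* Localization.Away hh) ≤
        (weightedFiltration (fun i => algebraMap (MvPolynomial (Fin 4) k) (Localization.Away hh) (X ((![0, 1, 2] : Fin 3 → Fin 4) i))) w).ideal n) :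
    cobordantAlgebra.u' (fun i => algebraMap (MvPolynomial (Fin 4) k) (Localization.Away hh) (X ((![0, 1, 2] : Fin 3 → Fin 4) i))) w 0 ∈
      (augmentationIdeal (sigmaR (sigmaAway σ hσh) _ w hσJ hp (qhl_iterate σ hh hσh hσp))).colon
        (Ideal.span {cobordantAlgebra.s (fun i => algebraMap (MvPolynomial (Fin 4) k) (Localization.Away hh) (X ((![0, 1, 2] : Fin 3 → Fin 4) i))) w ^ sh}) :=
  QhAbs.qha_u'_zero_mem_residual (sigmaAway σ hσh) _ w sh
    (by change sigmaAway σ hσh (algebraMap _ _ (X 1)) = algebraMap _ _ (X 1) + algebraMap _ _ (X 0); rw [sigmaAway_algebraMap, h1, map_add]) hw0 hp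
    (qhl_iterate σ hh hσh hσp) hσJ

include h3 in
/-- ★ `t̂ ∈ 𝔞` over `L`. -/
theorem qhl_tail_mem_residual
    (hσJ : ∀ n : ℕ, ((weightedFiltration (fun i => algebraMap (MvPolynomial (Fin 4) k) (Localization.Away hh) (X ((![0, 1, 2] : Fin 3 → Fin 4) i))) w).ideal n).map
      (sigmaAway σ hσh : Localization.Away hh →+* Localization.Away hh) ≤
        (weightedFiltration (fun i => algebraMap (MvPolynomial (Fin 4) k) (Localization.Away hh) (X ((![0, 1, 2] : Fin 3 → Fin 4) i))) w).ideal n)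
    (ht : algebraMap (MvPolynomial (Fin 4) k) (Localization.Away hh) t₀ ∈
      (weightedFiltration (fun i => algebraMap (MvPolynomial (Fin 4) k) (Localization.Away hh) (X ((![0, 1, 2] : Fin 3 → Fin 4) i))) w).ideal sh) :
    (⟨_, C_mul_T_mem_cobordantAlgebra _ _ ht⟩ : ↥(cobordantAlgebra (fun i => algebraMap (MvPolynomial (Fin 4) k) (Localization.Away hh) (X ((![0, 1, 2] : Fin 3 → Fin 4) i))) w)) ∈
      (augmentationIdeal (sigmaR (sigmaAway σ hσh) _ w hσJ hp (qhl_iterate σ hh hσh hσp))).colon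
        (Ideal.span {cobordantAlgebra.s (fun i => algebraMap (MvPolynomial (Fin 4) k) (Localization.Away hh) (X ((![0, 1, 2] : Fin 3 → Fin 4) i))) w ^ sh}) :=
  QhAbs.qha_tail_mem_residual (sigmaAway σ hσh) _ (algebraMap (MvPolynomial (Fin 4) k) (Localization.Away hh) (X 3)) (algebraMap (MvPolynomial (Fin 4) k) (Localization.Away hh) t₀) w sh
    (by rw [sigmaAway_algebraMap, h3, map_add]) ht hp
    (qhl_iterate σ hh hσh hσp) hσJ

end Residual

end Summit.ResolutionOfSingularities.ResolutionOfSingularities.Theorems.WildQuotientResolution.S1.KillCert.QhAway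

end
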